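/-
Copyright (c) 2026 the pub-hodgecm-mathlib formalisation cell (harness21).  Prover seat hodgecm-mathlib-K2E1-p15 (g3), Track B ∕ K2-LIT, h413 = `stmt-HodgeConjecture-24833`,
R90-TF section S8 «ContSpec-n½», deal S8-R153 (N = 2 twin, offer (e1)): the ★ N = 2 EIGEN head and ★ general-LEVEL print of the `χ`-Eisenstein exports of `U(1,1)_{L∕L⁺}`, re-run
KEEPING the core's (E5), so that (E2-bd) — `hEbd` (★ `locally_bounded_of_core_letters_cm_two`) — is EXPORTED next to (E1)–(E4).  The `2 ↤ 3` twin of ★ p863590.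
-/
import Summits.HodgeConjecture.HodgeConjecture.Theorems.K2E1ChiEisensteinJointLocalBoundCMTwo            -- 📤 p863602 (this seat): `locally_bounded_of_core_letters_cm_two`
import Summits.HodgeConjecture.HodgeConjecture.Theorems.K2E1ChiEisensteinMeromorphicExportsLevelCMTwo    -- ★ LEVEL print N = 2 (+ ★ EIGEN head, ★ conv data, ★ scattering coordinates transitively)
import HarnessLib

/-!
# S8 — `K2E1ChiEisensteinMeromorphicExportsWithBoundCMTwo`: the `χ`-Eisenstein exports of `U(1,1)_{L∕L⁺}` WITH the joint local bound (E2-bd) — ★ EIGEN head and ★ LEVEL print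
# re-run keeping (E5), `hEbd` exported on `Pᶜ` (the N = 2 twin of ★ p863590)

Track B ∕ K2-LIT, crux h413 = `stmt-HodgeConjecture-24833`, route of record `HCCMUnconditional`; cell `hodgecm-mathlib`, R90-TF programme, section S8 «ContSpec-n½».  THEOREMS ONLY (no
`def`, no `instance`, no `notation`, no named-fact hypothesis, no `sorry`; default heartbeats); lane `--supports stmt-HodgeConjecture-24833 --as helper` (count-neutral).  CLOSES NO
SOCKET.  The two ★ heads — `chiEisenstein_meromorphic_exports_cm_two_of_letters_of_eigen` and `chiEisenstein_meromorphic_exports_level_cm_two` — reproduced BYTE-FOR-BYTE (same binders,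
same proof), the core's (E5) clause kept in the final `obtain` and fed to ★ `locally_bounded_of_core_letters_cm_two`; the conclusion carries ONE MORE conjunct, (E2-bd):
`∀ z₁ ∉ P, ∀ K compact, ∃ V ∈ 𝓝 z₁, ∃ M, ∀ z ∈ V, ∀ g ∈ K, ‖Ec z g‖ ≤ M` — the standing letter `hEbd` of the N = 2 residue files (★ `K2E1EisensteinResidueLevelConstantU2Final`, ★
`K2E1ChiEisensteinDetTwistU2`, ★ `K2E1ContinuedEisensteinResidue*UTwo`) is thereby an EXPORT (modulo the pole ledger placing their domain `D` inside `Pᶜ`).  No ★ file is edited.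
* §1 **`chiEisenstein_meromorphic_exports_cm_two_of_letters_of_eigen_with_bound`**.  §2 **`chiEisenstein_meromorphic_exports_level_cm_two_with_bound`**.
HONEST LABEL: HC_CM is proved only modulo the 7 printed citations (2 remaining named inputs: hLiu418 = `stmt-HodgeConjecture-24832`, h413 = `stmt-HodgeConjecture-24833`) until
rung 0 closes; REL ≠ ★ ≠ BUILT; (E2-bd) is ONE letter — paying it retires no socket by itself; count-neutral.

## References
* [BernsteinLapid2019] J. Bernstein, E. Lapid, *On the meromorphic continuation of Eisenstein series*, J. Amer. Math. Soc. 37 (2024), Thm 2.3, §4, §7.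
* [MoeglinWaldspurger1995] C. Mœglin, J.-L. Waldspurger, *Spectral Decomposition and Eisenstein Series* (1995), II.1.7, IV.1.8–IV.1.11.
-/

set_option autoImplicit false
set_option linter.dupNamespace false  -- the mandated namespace repeats the summit's segment (`HodgeConjecture.HodgeConjecture`)

noncomputable section

open MeasureTheory Measure Filter Topology Set NumberField IsDedekindDomain
open scoped NNReal ENNReal Classical ComplexConjugate
open Literature.MeasureTheory.Group Literature.NumberTheory Literature.NumberTheory.Automorphic Literature.NumberTheory.Automorphic.UnitaryGroup AdelicGroupData
open Literature.NumberTheory.GaloisRepresentations (HeckeCharacter)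
open Summit.HodgeConjecture.HodgeConjecture.Cruxes.H413.K2E1BorelEisensteinU
open Summit.HodgeConjecture.HodgeConjecture.Cruxes.H413.K2E1BLBorelSpacesU2Defs
open Summit.HodgeConjecture.HodgeConjecture.Cruxes.H413.K2E1BLBorelOperatorsU2Defs
open Summit.HodgeConjecture.HodgeConjecture.Cruxes.H413.K2E1CharacterEisensteinU2Defs
open Summit.HodgeConjecture.HodgeConjecture.Cruxes.H413.K2E1ChiSectionSpaceU2Defs
open Summit.HodgeConjecture.HodgeConjecture.Cruxes.H413.K2E1ChiEisensteinBallPackageCMTwoScalar (exists_chi_ball_package_cm_two_of_letters')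
open Summit.HodgeConjecture.HodgeConjecture.Cruxes.H413.K2E1ChiEisensteinMeromorphicExportsU2Global (chiEisenstein_meromorphic_exports_core_of_packages meromorphicOn_patch_of_coDiscrete)
open Summit.HodgeConjecture.HodgeConjecture.Cruxes.H413.K2E1BLIotaClosedEmbeddingU2 (iotaBound_cm)
open Summit.HodgeConjecture.HodgeConjecture.Cruxes.H413.K2E1ChiEisensteinMeromorphicExportsU2GlobalCM (meromorphicOn_apply_of_pi)
open Summit.HodgeConjecture.HodgeConjecture.Cruxes.H413.K2E1ChiEisensteinBallPackageCMTwoEigen (exists_chi_ball_package_cm_two_of_eigen)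
open Summit.HodgeConjecture.HodgeConjecture.Cruxes.H413.K2E1ChiEisensteinMeromorphicExportsU2GlobalEigen (chiEisenstein_meromorphic_exports_core_of_packages_of_eigen)
open scoped NNReal ENNReal
open Summit.HodgeConjecture.HodgeConjecture.Cruxes.H413.K2E1ChiEisensteinMeromorphicExportsU2GlobalCMEigen (chiEisenstein_meromorphic_exports_cm_two_of_letters_of_eigen)
open Summit.HodgeConjecture.HodgeConjecture.Cruxes.H413.K2E1ChiConvDataLevelCMTwo (exists_chi_convData_level_cm_two)
open Summit.HodgeConjecture.HodgeConjecture.Cruxes.H413.K2E1ChiScatteringCoordsHolomorphicCMTwo (exists_scatteringCoords_of_basis_cm_two)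
open Summit.HodgeConjecture.HodgeConjecture.Cruxes.H413.K2E1ChiEisensteinJointLocalBoundCMTwo (locally_bounded_of_core_letters_cm_two)

namespace Summit.HodgeConjecture.HodgeConjecture.Cruxes.H413.K2E1ChiEisensteinMeromorphicExportsWithBoundCMTwo

variable (L : Type) [Field L] [NumberField L] [IsCMField L]
  [MeasurableSpace (quasiSplit (↥(maximalRealSubfield L)) L (IsCMField.complexConj L) 2).Adelic] [BorelSpace (quasiSplit (↥(maximalRealSubfield L)) L (IsCMField.complexConj L) 2).Adelic]

/-! ## §1 EIGEN head with (E2-bd) -/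

/-- **X2_χ (A) AT THE CM PAIR, `N = 2`, GENERIC-EIGENVALUE EDITION, WITH THE JOINT LOCAL BOUND**: ★ `chiEisenstein_meromorphic_exports_cm_two_of_letters_of_eigen` byte-for-byte, its
conclusion extended by (E2-bd) (★ `locally_bounded_of_core_letters_cm_two` on the core's (E5)). [cite: BernsteinLapid2019, Thm 2.3, §4, §7] [cite: MoeglinWaldspurger1995, IV.1.8–IV.1.11] -/
theorem chiEisenstein_meromorphic_exports_cm_two_of_letters_of_eigen_with_bound
    (μ : Measure (quasiSplit (↥(maximalRealSubfield L)) L (IsCMField.complexConj L) 2).automorphicQuotient) [(quasiSplit (↥(maximalRealSubfield L)) L (IsCMField.complexConj L) 2).IsAutomorphicMeasure μ]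
    (νG : Measure (quasiSplit (↥(maximalRealSubfield L)) L (IsCMField.complexConj L) 2).Adelic) [νG.IsHaarMeasure] [νG.IsInvInvariant] [SFinite νG]
    (ν : Measure ↥(adelicUnipotent (↥(maximalRealSubfield L)) L (IsCMField.complexConj L) 2)) [ν.IsHaarMeasure] [ν.IsMulRightInvariant] [ν.IsInvInvariant]
    {𝓕 : Set ↥(adelicUnipotent (↥(maximalRealSubfield L)) L (IsCMField.complexConj L) 2)}
    (h𝓕N : IsFundamentalDomain ↥(rationalUnipotent (↥(maximalRealSubfield L)) L (IsCMField.complexConj L) 2) 𝓕 ν) (h𝓕c : IsCompact (closure 𝓕)) (h𝓕₀ : ν 𝓕 ≠ 0)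
    {β : (quasiSplit (↥(maximalRealSubfield L)) L (IsCMField.complexConj L) 2).Adelic → ℝ≥0∞}
    (hβ : IsCoveringWeight ↥((arithmeticBorel (↥(maximalRealSubfield L)) L (IsCMField.complexConj L) 2).map (quasiSplit (↥(maximalRealSubfield L)) L (IsCMField.complexConj L) 2).arithmeticSubgroup.subtype) β)
    {μZ : Measure (borelQuotient (↥(maximalRealSubfield L)) L (IsCMField.complexConj L) 2)} [SFinite μZ]
    (hμZ : ∀ f : borelQuotient (↥(maximalRealSubfield L)) L (IsCMField.complexConj L) 2 → ℝ≥0∞, Measurable f → ∫⁻ z, f z ∂μZ = ∫⁻ g, β g * f (toBorelQuotient (↥(maximalRealSubfield L)) L (IsCMField.complexConj L) 2 g) ∂νG)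
    -- the section data
    {χ : HeckeCharacter L} {K' : Subgroup (quasiSplit (↥(maximalRealSubfield L)) L (IsCMField.complexConj L) 2).Adelic} {ω : ↥K' → ℂ} {φ : (quasiSplit (↥(maximalRealSubfield L)) L (IsCMField.complexConj L) 2).Adelic → ℂ} (hφV : φ ∈ chiSectionSpace χ K' ω) (hφc : Continuous φ) {Mφ : ℝ} (hφM : ∀ x, ‖φ x‖ ≤ Mφ)
    {ι' : Type} [Fintype ι'] {φ' : ι' → (quasiSplit (↥(maximalRealSubfield L)) L (IsCMField.complexConj L) 2).Adelic → ℂ} (hli : LinearIndependent ℂ φ') (hφ'c : ∀ j, Continuous (φ' j))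
    (hφ'χ : ∀ j, IsChiSection (reflectChar (IsCMField.complexConj L) χ) (φ' j)) {Mb : ℝ} (hφ'M : ∀ j x, ‖φ' j x‖ ≤ Mb)
    -- THE LETTERS `hq`∕`hqφ`: the scattering coordinates on the Godement half-plane
    (q : ι' → ℂ → ℂ) (hq : ∀ j, DifferentiableOn ℂ (q j) {z : ℂ | 1 < z.re})
    (hqφ : ∀ z : ℂ, 1 < z.re → (∑ j, q j z • φ' j) = ((((ν 𝓕).toReal⁻¹ : ℝ)) : ℂ) • (fun g : (quasiSplit (↥(maximalRealSubfield L)) L (IsCMField.complexConj L) 2).Adelic => (∫ v : ↥(adelicUnipotent (↥(maximalRealSubfield L)) L (IsCMField.complexConj L) 2), flatSectionU φ z ((quasiSplit (↥(maximalRealSubfield L)) L (IsCMField.complexConj L) 2).toAdelic (weylLongU ((IsCMField.complexConj L : L ≃ₐ[↥(maximalRealSubfield L)] L) : L →+* L) (rfl : (StdForm.antidiagonal 2).over L = (StdForm.antidiagonal 2).over L)) * ((v : (quasiSplit (↥(maximalRealSubfield L)) L (IsCMField.complexConj L) 2).Adelic) * g)) ∂ν) * (((borelHeight g : ℝ) :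 ℂ) ^ (z - 1))))
    -- THE LETTER BUNDLE `hCD` (EIGENVALUE CURRENCY): per ball, EXACTLY the conclusion of ★ `exists_chi_convData_cm_two` at `V := chiSectionSpace χ K′ ω` (★ p860739 at any level)
    (hCD : ∀ n : ℕ,
      ∃ (a : ℝ≥0) (ha : 0 < a) (I : Type) (_ : Fintype I) (i₀ : I) (η : I → GL (Fin 2) (AdeleRing (𝓞 L) L) → ℝ) (κ : I → ℝ≥0)
        (T : I → HX (↥(maximalRealSubfield L)) L (IsCMField.complexConj L) 2 (n + 3) μ →L[ℂ] HX (↥(maximalRealSubfield L)) L (IsCMField.complexConj L) 2 (n + 3) μ) (ŝ : I → ℂ → ℂ),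
        -- the test functions `η_i` (smooth, non-negative, symmetric) and the self-convolutions `h_i = S_{η_i} η_i` (continuous, compactly supported, symmetric, real, `Re ≥ 0`)
        (∀ i, IsTestFunctionGL 2 L (η i) ∧ (∀ g, 0 ≤ η i g) ∧ (∀ g, η i g⁻¹ = η i g)) ∧
        (∀ i, Continuous (fun y : (quasiSplit (↥(maximalRealSubfield L)) L (IsCMField.complexConj L) 2).Adelic => orbitalSmoothing νG (fun x : (quasiSplit (↥(maximalRealSubfield L)) L (IsCMField.complexConj L) 2).Adelic => ((η i (adelicVal (↥(maximalRealSubfield L)) L (IsCMField.complexConj L) 2 ((StdForm.antidiagonal 2).over L) x) : ℝ) : ℂ)) (fun x : (quasiSplit (↥(maximalRealSubfield L)) L (IsCMField.complexConj L) 2).Adelic => ((η i (adelicVal (↥(maximalRealSubfield L)) L (IsCMField.complexConj L) 2 ((StdForm.antidiagonal 2).over L) x) : ℝ) : ℂ)) y) ∧ HasCompactSupport (fun y : (quasiSplit (↥(maximalRealSubfield L)) L (IsCMField.complexConj L) 2).Adelic => orbitalSmoothing νG (fun x : (quasiSplit (↥(maximalRealSubfield L)) L (IsCMField.complexConj L)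 2).Adelic => ((η i (adelicVal (↥(maximalRealSubfield L)) L (IsCMField.complexConj L) 2 ((StdForm.antidiagonal 2).over L) x) : ℝ) : ℂ)) (fun x : (quasiSplit (↥(maximalRealSubfield L)) L (IsCMField.complexConj L) 2).Adelic => ((η i (adelicVal (↥(maximalRealSubfield L)) L (IsCMField.complexConj L) 2 ((StdForm.antidiagonal 2).over L) x) : ℝ) : ℂ)) y) ∧
          (∀ g, (fun y : (quasiSplit (↥(maximalRealSubfield L)) L (IsCMField.complexConj L) 2).Adelic => orbitalSmoothing νG (fun x : (quasiSplit (↥(maximalRealSubfield L)) L (IsCMField.complexConj L) 2).Adelic => ((η i (adelicVal (↥(maximalRealSubfield L)) L (IsCMField.complexConj L) 2 ((StdForm.antidiagonal 2).over L) x) : ℝ) : ℂ)) (fun x : (quasiSplit (↥(maximalRealSubfield L)) L (IsCMField.complexConj L) 2).Adelic => ((η i (adelicVal (↥(maximalRealSubfield L)) L (IsCMField.complexConj L) 2 ((StdForm.antidiagonal 2).over L) x) : ℝ) : ℂ)) y) g⁻¹ = (fun y : (quasiSplit (↥(maximalRealSubfield L)) L (IsCMField.complexConj L) 2).Adelic =>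 orbitalSmoothing νG (fun x : (quasiSplit (↥(maximalRealSubfield L)) L (IsCMField.complexConj L) 2).Adelic => ((η i (adelicVal (↥(maximalRealSubfield L)) L (IsCMField.complexConj L) 2 ((StdForm.antidiagonal 2).over L) x) : ℝ) : ℂ)) (fun x : (quasiSplit (↥(maximalRealSubfield L)) L (IsCMField.complexConj L) 2).Adelic => ((η i (adelicVal (↥(maximalRealSubfield L)) L (IsCMField.complexConj L) 2 ((StdForm.antidiagonal 2).over L) x) : ℝ) : ℂ)) y) g) ∧ (∀ g, conj ((fun y : (quasiSplit (↥(maximalRealSubfield L)) L (IsCMField.complexConj L) 2).Adelic => orbitalSmoothing νG (fun x : (quasiSplit (↥(maximalRealSubfield L)) L (IsCMField.complexConj L) 2).Adelic => ((η i (adelicVal (↥(maximalRealSubfield L)) L (IsCMField.complexConj L) 2 ((StdForm.antidiagonal 2).over L) x) : ℝ) : ℂ)) (fun x : (quasiSplit (↥(maximalRealSubfield L)) L (IsCMField.complexConj L) 2).Adelic => ((η i (adelicVal (↥(maximalRealSubfield L)) L (IsCMField.complexConj L) 2 ((StdForm.antidiagonal 2).over L) x) : ℝ) : ℂ)) y)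 g) = (fun y : (quasiSplit (↥(maximalRealSubfield L)) L (IsCMField.complexConj L) 2).Adelic => orbitalSmoothing νG (fun x : (quasiSplit (↥(maximalRealSubfield L)) L (IsCMField.complexConj L) 2).Adelic => ((η i (adelicVal (↥(maximalRealSubfield L)) L (IsCMField.complexConj L) 2 ((StdForm.antidiagonal 2).over L) x) : ℝ) : ℂ)) (fun x : (quasiSplit (↥(maximalRealSubfield L)) L (IsCMField.complexConj L) 2).Adelic => ((η i (adelicVal (↥(maximalRealSubfield L)) L (IsCMField.complexConj L) 2 ((StdForm.antidiagonal 2).over L) x) : ℝ) : ℂ)) y) g) ∧ (∀ g, 0 ≤ ((fun y : (quasiSplit (↥(maximalRealSubfield L)) L (IsCMField.complexConj L) 2).Adelic => orbitalSmoothing νG (fun x : (quasiSplit (↥(maximalRealSubfield L)) L (IsCMField.complexConj L) 2).Adelic => ((η i (adelicVal (↥(maximalRealSubfield L)) L (IsCMField.complexConj L) 2 ((StdForm.antidiagonal 2).over L) x) : ℝ) : ℂ)) (fun x : (quasiSplit (↥(maximalRealSubfield L)) L (IsCMField.complexConj L) 2).Adelic => ((η i (adelicVal (↥(maximalRealSubfield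 L)) L (IsCMField.complexConj L) 2 ((StdForm.antidiagonal 2).over L) x) : ℝ) : ℂ)) y) g).re)) ∧
        -- the EIGENVALUE FUNCTIONS `ŝ_i` (entire), the scalar action of `h_i` on `V ⊗ H^z`, the cover of the ball, and the non-constant member `i₀`
        (∀ i, Differentiable ℂ (ŝ i)) ∧
        (∀ i, ∀ z : ℂ, ∀ φ ∈ chiSectionSpace χ K' ω, ∀ x : (quasiSplit (↥(maximalRealSubfield L)) L (IsCMField.complexConj L) 2).Adelic, (∫ y, (fun y : (quasiSplit (↥(maximalRealSubfield L)) L (IsCMField.complexConj L) 2).Adelic => orbitalSmoothing νG (fun x : (quasiSplit (↥(maximalRealSubfield L)) L (IsCMField.complexConj L) 2).Adelic => ((η i (adelicVal (↥(maximalRealSubfield L)) L (IsCMField.complexConj L) 2 ((StdForm.antidiagonal 2).over L) x) : ℝ) : ℂ)) (fun x : (quasiSplit (↥(maximalRealSubfield L)) L (IsCMField.complexConj L) 2).Adelic => ((η i (adelicVal (↥(maximalRealSubfield L)) L (IsCMField.complexConj L) 2 ((StdForm.antidiagonal 2).over L) x) : ℝ) : ℂ)) y) y * flatSectionU φ z (x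 * y) ∂νG) = ŝ i z * flatSectionU φ z x) ∧
        (∀ z ∈ Metric.ball (0 : ℂ) (n + 2), ∃ i, ŝ i z ≠ 0) ∧
        (∃ z₁ z₂ : ℂ, ŝ i₀ z₁ ≠ ŝ i₀ z₂) ∧ (∃ z ∈ Metric.ball (0 : ℂ) (n + 2), ŝ i₀ z ≠ 0) ∧
        (∀ i, 1 ≤ κ i ∧ a ≤ κ i * a) ∧
        (∀ i, ∀ z : borelQuotient (↥(maximalRealSubfield L)) L (IsCMField.complexConj L) 2, ∀ y ∈ tsupport (fun y : (quasiSplit (↥(maximalRealSubfield L)) L (IsCMField.complexConj L) 2).Adelic => orbitalSmoothing νG (fun x : (quasiSplit (↥(maximalRealSubfield L)) L (IsCMField.complexConj L) 2).Adelic => ((η i (adelicVal (↥(maximalRealSubfield L)) L (IsCMField.complexConj L) 2 ((StdForm.antidiagonal 2).over L) x) : ℝ) : ℂ)) (fun x : (quasiSplit (↥(maximalRealSubfield L)) L (IsCMField.complexConj L) 2).Adelic => ((η i (adelicVal (↥(maximalRealSubfield L)) L (IsCMField.complexConj L) 2 ((StdForm.antidiagonal 2).over L) x) : ℝ) : ℂ))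 y), borelQuotHeight (↥(maximalRealSubfield L)) L (IsCMField.complexConj L) 2 z ≤ κ i * borelQuotHeight (↥(maximalRealSubfield L)) L (IsCMField.complexConj L) 2 (rightShift (↥(maximalRealSubfield L)) L (IsCMField.complexConj L) 2 y z)) ∧
        (∀ i, ∃ hpos : 0 < κ i * a, Function.Injective (iota (iotaBound_cm L μ νG hβ hμZ hpos (n + 3))) ∧
          IsClosed ((LinearMap.range (iota (iotaBound_cm L μ νG hβ hμZ hpos (n + 3))).toLinearMap :
            Submodule ℂ (HN (↥(maximalRealSubfield L)) L (IsCMField.complexConj L) 2 (n + 3) (κ i * a) μZ)) : Set (HN (↥(maximalRealSubfield L)) L (IsCMField.complexConj L) 2 (n + 3) (κ i * a) μZ))) ∧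
        μZ {z | a < borelQuotHeight (↥(maximalRealSubfield L)) L (IsCMField.complexConj L) 2 z} ≠ 0 ∧
        (∀ i, ∀ u : HX (↥(maximalRealSubfield L)) L (IsCMField.complexConj L) 2 (n + 3) μ,
          (T i u : (quasiSplit (↥(maximalRealSubfield L)) L (IsCMField.complexConj L) 2).automorphicQuotient → ℂ) =ᵐ[μ.withDensity fun x =>
              (((supHeight (↥(maximalRealSubfield L)) L (IsCMField.complexConj L) 2 x)⁻¹ ^ (2 * (n + 3)) : ℝ≥0) : ℝ≥0∞)]
            fun ξ => ∫ y, (fun y : (quasiSplit (↥(maximalRealSubfield L)) L (IsCMField.complexConj L) 2).Adelic => orbitalSmoothing νG (fun x : (quasiSplit (↥(maximalRealSubfield L)) L (IsCMField.complexConj L) 2).Adelic => ((η i (adelicVal (↥(maximalRealSubfield L)) L (IsCMField.complexConj L) 2 ((StdForm.antidiagonal 2).over L) x) : ℝ) : ℂ)) (fun x : (quasiSplit (↥(maximalRealSubfield L)) L (IsCMField.complexConj L) 2).Adelic => ((η i (adelicVal (↥(maximalRealSubfield L)) L (IsCMField.complexConj L) 2 ((StdForm.antidiagonal 2).over L) x)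 : ℝ) : ℂ)) y) y * (u : (quasiSplit (↥(maximalRealSubfield L)) L (IsCMField.complexConj L) 2).automorphicQuotient → ℂ) (y⁻¹ • ξ) ∂νG) ∧
        (∀ i, ∃ hs : ShiftBound (↥(maximalRealSubfield L)) L (IsCMField.complexConj L) 2 (n + 3) a (κ i * a) νG μZ (fun y : (quasiSplit (↥(maximalRealSubfield L)) L (IsCMField.complexConj L) 2).Adelic => orbitalSmoothing νG (fun x : (quasiSplit (↥(maximalRealSubfield L)) L (IsCMField.complexConj L) 2).Adelic => ((η i (adelicVal (↥(maximalRealSubfield L)) L (IsCMField.complexConj L) 2 ((StdForm.antidiagonal 2).over L) x) : ℝ) : ℂ)) (fun x : (quasiSplit (↥(maximalRealSubfield L)) L (IsCMField.complexConj L) 2).Adelic => ((η i (adelicVal (↥(maximalRealSubfield L)) L (IsCMField.complexConj L) 2 ((StdForm.antidiagonal 2).over L) x) : ℝ) : ℂ)) y),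
          ∀ (h01 : a ≤ κ i * a),
            deltaShift hs ∘L iota (iotaBound_cm L μ νG hβ hμZ ha (n + 3)) =
              restrHN (↥(maximalRealSubfield L)) L (IsCMField.complexConj L) 2 (n + 3) h01 μZ ∘L iota (iotaBound_cm L μ νG hβ hμZ ha (n + 3)) ∘L T i)) :
    ∃ (Ec : ℂ → (quasiSplit (↥(maximalRealSubfield L)) L (IsCMField.complexConj L) 2).Adelic → ℂ) (qc : ι' → ℂ → ℂ) (P : Set ℂ),
      (∀ g, MeromorphicNFOn (fun z => Ec z g) univ) ∧ (∀ j, MeromorphicNFOn (qc j) univ) ∧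
      (∀ z : ℂ, 1 < z.re → Ec z = eisensteinSeriesU (flatSectionU φ z)) ∧ (∀ j (z : ℂ), 1 < z.re → qc j z = q j z) ∧
      IsClosed P ∧ (∀ z₀ : ℂ, ∀ᶠ s in 𝓝[≠] z₀, s ∉ P) ∧ (∀ z ∈ P, z.re ≤ 1) ∧
      (∀ g (z : ℂ), z ∉ P → AnalyticAt ℂ (fun z => Ec z g) z) ∧ (∀ j (z : ℂ), z ∉ P → AnalyticAt ℂ (qc j) z) ∧
      (∀ g, DifferentiableOn ℂ (fun z => Ec z g) Pᶜ) ∧ (∀ j, DifferentiableOn ℂ (qc j) Pᶜ) ∧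
      (∀ z : ℂ, z ∉ P → Continuous (Ec z)) ∧
      -- (E2-bd) THE JOINT LOCAL BOUND off `P`
      (∀ z₁ : ℂ, z₁ ∉ P → ∀ K : Set (quasiSplit (↥(maximalRealSubfield L)) L (IsCMField.complexConj L) 2).Adelic, IsCompact K → ∃ V ∈ 𝓝 z₁, ∃ M : ℝ, ∀ z ∈ V, ∀ g ∈ K, ‖Ec z g‖ ≤ M) := by
  -- the per-ball (χ,τ) convolution data WITH eigenvalues, chosen over `n`
  choose a ha I hI i₀ η κ T ŝ hη hconv hŝd hact hcov hnc _hne0 hκ hcmp hι _hμZ hT hpack using hCD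
  -- the per-ball packages of 📤 X1_χ §2c-eigen at the coordinates `bX z := (q_j z)_j`
  have P0 := fun n : ℕ => exists_chi_ball_package_cm_two_of_eigen L μ νG ν h𝓕N h𝓕c h𝓕₀ hβ hμZ n (i₀ n) (η n) (ha n) (κ n) (T n) (ŝ n) (hŝd n) (hnc n)
    (fun i => (hη n i).1) (hconv n) (hcov n) (hκ n) (hcmp n) (hι n) (hT n) (hpack n) hφV hφc hφM hli hφ'c hφ'χ hφ'M (fun z j => q j z) (fun z _ hz1 => hqφ z hz1)
    (fun i z _ x => hact n i z φ hφV x)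
  choose U vX cc hb α₁ col hUo hUD hDcl hUcd hvXd hvXm hccd hccm hα₁ae hcolae heqs hunq hgod hR4 using P0
  choose Ecb hEcm hEcg hEco hgerm using hR4
  -- the coefficient pieces: the components of `cc n`, patched to `q_j` on the Godement half-plane (★ `meromorphicOn_patch_of_coDiscrete`)
  have hpatch : ∀ (j : ι') (n : ℕ), MeromorphicOn (fun s => if (1 : ℝ) < s.re then q j s else cc n s j) (Metric.ball (0 : ℂ) (n + 2)) ∧
      (∀ z ∈ Metric.ball (0 : ℂ) (n + 2), (1 : ℝ) < z.re → (fun s => if (1 : ℝ) < s.re then q j s else cc n s j) z = q j z) ∧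
      ∀ z ∈ Metric.ball (0 : ℂ) (n + 2), z ∈ U n → 0 ≤ meromorphicOrderAt (fun s => if (1 : ℝ) < s.re then q j s else cc n s j) z := fun j n =>
    (meromorphicOn_patch_of_coDiscrete (hUo n) (hUcd n) (σ₀ := (1 : ℝ)) (cc := fun z => cc n z j) (q := q j) (differentiableOn_pi.1 (hccd n) j)
      (meromorphicOn_apply_of_pi (hccm n) j) (fun z hz hz1 => by rw [(hgod n z hz hz1).2])).2
  -- ONE call of ★ X2_χ core, generic-eigenvalue edition
  obtain ⟨Ec, qc, P, hEcNF, hqcNF, hEcE, hqcq, -, -, hPc, hPcd, hPre, -, hEan, hqan, hEdiff, hqdiff, hE5, hEcont⟩ :=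
    chiEisenstein_meromorphic_exports_core_of_packages_of_eigen L μ νG hφc hφM 0 (fun n => n + 3) (I := I) (fun n i => (fun (i : I n) (y : (quasiSplit (↥(maximalRealSubfield L)) L (IsCMField.complexConj L) 2).Adelic) => orbitalSmoothing νG (fun x : (quasiSplit (↥(maximalRealSubfield L)) L (IsCMField.complexConj L) 2).Adelic => ((η n i (adelicVal (↥(maximalRealSubfield L)) L (IsCMField.complexConj L) 2 ((StdForm.antidiagonal 2).over L) x) : ℝ) : ℂ)) (fun x : (quasiSplit (↥(maximalRealSubfield L)) L (IsCMField.complexConj L) 2).Adelic => ((η n i (adelicVal (↥(maximalRealSubfield L)) L (IsCMField.complexConj L) 2 ((StdForm.antidiagonal 2).over L) x) : ℝ) : ℂ)) y) i)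
      (fun n i => (hconv n i).1) (fun n i => (hconv n i).2.1) (fun n i x => (hconv n i).2.2.2.1 x) ŝ hŝd (fun n _ => hcov n)
      (U := U) (fun n _ => hUo n) (fun n _ => hUD n) (fun n _ => hUcd n) vX (fun n _ => hvXd n)
      (F := fun g n => Ecb n g) (fun g n _ => hEcm n g) (fun g n _ => hEcg n g) (fun g n _ z _ hzU => hEco n g z hzU) (fun g n _ => hgerm n g)
      (q := q) hq (Fq := fun j n s => if (1 : ℝ) < s.re then q j s else cc n s j) (fun j n _ => (hpatch j n).1) (fun j n _ => (hpatch j n).2.1) (fun j n _ => (hpatch j n).2.2)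
  exact ⟨Ec, qc, P, hEcNF, hqcNF, hEcE, hqcq, hPc, hPcd, hPre, hEan, hqan, hEdiff, hqdiff, hEcont,
    -- (E2-bd): ★ `locally_bounded_of_core_letters_cm_two` on the core's own letters and its (E5)
    locally_bounded_of_core_letters_cm_two L μ νG 0 (fun n => n + 3) (fun n i => (fun (i : I n) (y : (quasiSplit (↥(maximalRealSubfield L)) L (IsCMField.complexConj L) 2).Adelic) => orbitalSmoothing νG (fun x : (quasiSplit (↥(maximalRealSubfield L)) L (IsCMField.complexConj L) 2).Adelic => ((η n i (adelicVal (↥(maximalRealSubfield L)) L (IsCMField.complexConj L) 2 ((StdForm.antidiagonal 2).over L) x) : ℝ) : ℂ)) (fun x : (quasiSplit (↥(maximalRealSubfield L)) L (IsCMField.complexConj L) 2).Adelic => ((η n i (adelicVal (↥(maximalRealSubfield L)) L (IsCMField.complexConj L) 2 ((StdForm.antidiagonal 2).over L) x) : ℝ) : ℂ)) y) i)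
      (fun n i => (hconv n i).1) (fun n i => (hconv n i).2.1) (fun n i x => (hconv n i).2.2.2.1 x) ŝ hŝd (fun n _ => hcov n)
      (fun n _ => hUo n) (fun n _ => hUD n) (fun n _ => hUcd n) vX (fun n _ => hvXd n) hPc hEdiff hE5⟩

/-! ## §2 LEVEL print with (E2-bd) -/

section Level

variable [MeasurableSpace (arch (↥(maximalRealSubfield L)) L (IsCMField.complexConj L) 2 ((StdForm.antidiagonal 2).over L))] [BorelSpace (arch (↥(maximalRealSubfield L)) L (IsCMField.complexConj L) 2 ((StdForm.antidiagonal 2).over L))]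
  [MeasurableSpace (finAdelic (↥(maximalRealSubfield L)) L (IsCMField.complexConj L) 2 ((StdForm.antidiagonal 2).over L))] [BorelSpace (finAdelic (↥(maximalRealSubfield L)) L (IsCMField.complexConj L) 2 ((StdForm.antidiagonal 2).over L))]

/-- **THE GENERAL-LEVEL PRINT (N = 2) WITH THE JOINT LOCAL BOUND**: ★ `chiEisenstein_meromorphic_exports_level_cm_two` byte-for-byte, conclusion extended by (E2-bd).
[cite: BernsteinLapid2019, Thm 2.3, §4, §7] [cite: MoeglinWaldspurger1995, II.1.7, IV.1.8–IV.1.11] -/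
theorem chiEisenstein_meromorphic_exports_level_cm_two_with_bound
    (μ : Measure (quasiSplit (↥(maximalRealSubfield L)) L (IsCMField.complexConj L) 2).automorphicQuotient) [(quasiSplit (↥(maximalRealSubfield L)) L (IsCMField.complexConj L) 2).IsAutomorphicMeasure μ]
    (νG : Measure (quasiSplit (↥(maximalRealSubfield L)) L (IsCMField.complexConj L) 2).Adelic) [νG.IsHaarMeasure] [νG.IsInvInvariant] [SFinite νG]
    (ν : Measure ↥(adelicUnipotent (↥(maximalRealSubfield L)) L (IsCMField.complexConj L) 2)) [ν.IsHaarMeasure] [ν.IsMulRightInvariant] [ν.IsInvInvariant]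
    {𝓕 : Set ↥(adelicUnipotent (↥(maximalRealSubfield L)) L (IsCMField.complexConj L) 2)}
    (h𝓕N : IsFundamentalDomain ↥(rationalUnipotent (↥(maximalRealSubfield L)) L (IsCMField.complexConj L) 2) 𝓕 ν) (h𝓕c : IsCompact (closure 𝓕)) (h𝓕₀ : ν 𝓕 ≠ 0)
    {β : (quasiSplit (↥(maximalRealSubfield L)) L (IsCMField.complexConj L) 2).Adelic → ℝ≥0∞}
    (hβ : IsCoveringWeight ↥((arithmeticBorel (↥(maximalRealSubfield L)) L (IsCMField.complexConj L) 2).map (quasiSplit (↥(maximalRealSubfield L)) L (IsCMField.complexConj L) 2).arithmeticSubgroup.subtype) β)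
    {μZ : Measure (borelQuotient (↥(maximalRealSubfield L)) L (IsCMField.complexConj L) 2)} [SFinite μZ]
    (hμZ : ∀ f : borelQuotient (↥(maximalRealSubfield L)) L (IsCMField.complexConj L) 2 → ℝ≥0∞, Measurable f → ∫⁻ z, f z ∂μZ = ∫⁻ g, β g * f (toBorelQuotient (↥(maximalRealSubfield L)) L (IsCMField.complexConj L) 2 g) ∂νG)
    -- the M1 family: `φ ∈ V(χ, K, 1)` continuous bounded with `φ ∘ ι_∞ = φ(1)`, and a basis of `V(χʷ, K, 1)` by continuous bounded functions
    {χ : HeckeCharacter L} {K' : Subgroup (quasiSplit (↥(maximalRealSubfield L)) L (IsCMField.complexConj L) 2).Adelic} {ω : ↥K' → ℂ} {φ : (quasiSplit (↥(maximalRealSubfield L)) L (IsCMField.complexConj L) 2).Adelic → ℂ} (hφV : φ ∈ chiSectionSpace χ K' ω) (hφc : Continuous φ) {Mφ : ℝ} (hφM : ∀ x, ‖φ x‖ ≤ Mφ)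
    -- the LEVEL: `K′ ≤ K`, `ι(K_∞) ⊆ K′`, an open compact `U₀` with `ι_f(U₀ ∩ G_f) ⊆ K′` on which `ω = 1`, continuity of the sections; auxiliary Haar measures on `G_∞` (two-sided) and `G(𝔸_f)`
    (hK' : K' ≤ ((standardMaximalCompactGL 2 L).comap (adelicVal (↥(maximalRealSubfield L)) L (IsCMField.complexConj L) 2 ((StdForm.antidiagonal 2).over L)) : Subgroup (quasiSplit (↥(maximalRealSubfield L)) L (IsCMField.complexConj L) 2).Adelic))
    (hKinf : ∀ k : arch (↥(maximalRealSubfield L)) L (IsCMField.complexConj L) 2 ((StdForm.antidiagonal 2).over L), adelicVal (↥(maximalRealSubfield L)) L (IsCMField.complexConj L) 2 ((StdForm.antidiagonal 2).over L) (archToAdelic (↥(maximalRealSubfield L)) L (IsCMField.complexConj L) 2 _ k) ∈ standardMaximalCompactGL 2 L →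
      archToAdelic (↥(maximalRealSubfield L)) L (IsCMField.complexConj L) 2 _ k ∈ K')
    (U₀ : Subgroup (GL (Fin 2) (FiniteAdeleRing (𝓞 L) L))) (hU₀o : IsOpen (U₀ : Set (GL (Fin 2) (FiniteAdeleRing (𝓞 L) L)))) (hU₀c : IsCompact (U₀ : Set (GL (Fin 2) (FiniteAdeleRing (𝓞 L) L))))
    (hU : ∀ b : finAdelic (↥(maximalRealSubfield L)) L (IsCMField.complexConj L) 2 ((StdForm.antidiagonal 2).over L), (b : GL (Fin 2) (FiniteAdeleRing (𝓞 L) L)) ∈ U₀ →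
      ∃ hb : finAdelicToAdelic (↥(maximalRealSubfield L)) L (IsCMField.complexConj L) 2 ((StdForm.antidiagonal 2).over L) b ∈ K', ω ⟨_, hb⟩ = 1)
    (hVc : ∀ φ ∈ chiSectionSpace χ K' ω, Continuous φ)
    (μa : Measure (arch (↥(maximalRealSubfield L)) L (IsCMField.complexConj L) 2 ((StdForm.antidiagonal 2).over L))) [μa.IsHaarMeasure] [μa.IsMulRightInvariant]
    (μf : Measure (finAdelic (↥(maximalRealSubfield L)) L (IsCMField.complexConj L) 2 ((StdForm.antidiagonal 2).over L))) [μf.IsHaarMeasure]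
    {ι' : Type} [Fintype ι'] [DecidableEq ι'] (bV : Module.Basis ι' ℂ ↥(chiSectionSpace (reflectChar (IsCMField.complexConj L) χ) K' ω))
    (hbc : ∀ j, Continuous ((bV j : ↥(chiSectionSpace (reflectChar (IsCMField.complexConj L) χ) K' ω)) : (quasiSplit (↥(maximalRealSubfield L)) L (IsCMField.complexConj L) 2).Adelic → ℂ)) {Mb : ℝ} (hbM : ∀ j x, ‖((bV j : ↥(chiSectionSpace (reflectChar (IsCMField.complexConj L) χ) K' ω)) : (quasiSplit (↥(maximalRealSubfield L)) L (IsCMField.complexConj L) 2).Adelic → ℂ) x‖ ≤ Mb) :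
    ∃ (q : ι' → ℂ → ℂ) (Ec : ℂ → (quasiSplit (↥(maximalRealSubfield L)) L (IsCMField.complexConj L) 2).Adelic → ℂ) (qc : ι' → ℂ → ℂ) (P : Set ℂ),
      (∀ j, DifferentiableOn ℂ (q j) {z : ℂ | 1 < z.re}) ∧
      (∀ z : ℂ, 1 < z.re → (∑ j, q j z • ((bV j : ↥(chiSectionSpace (reflectChar (IsCMField.complexConj L) χ) K' ω)) : (quasiSplit (↥(maximalRealSubfield L)) L (IsCMField.complexConj L) 2).Adelic → ℂ)) = ((((ν 𝓕).toReal⁻¹ : ℝ)) : ℂ) • (fun g : (quasiSplit (↥(maximalRealSubfield L)) L (IsCMField.complexConj L) 2).Adelic => (∫ v : ↥(adelicUnipotent (↥(maximalRealSubfield L)) L (IsCMField.complexConj L) 2), flatSectionU φ z ((quasiSplit (↥(maximalRealSubfield L)) L (IsCMField.complexConj L) 2).toAdelic (weylLongU ((IsCMField.complexConj L : L ≃ₐ[↥(maximalRealSubfield L)] L) : L →+* L) (rfl : (StdForm.antidiagonal 2).over L = (StdForm.antidiagonal 2).over L)) * ((v : (quasiSplit (↥(maximalRealSubfield L)) L (IsCMField.complexConj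 L) 2).Adelic) * g)) ∂ν) * (((borelHeight g : ℝ) : ℂ) ^ (z - 1)))) ∧
      (∀ g, MeromorphicNFOn (fun z => Ec z g) univ) ∧ (∀ j, MeromorphicNFOn (qc j) univ) ∧
      (∀ z : ℂ, 1 < z.re → Ec z = eisensteinSeriesU (flatSectionU φ z)) ∧ (∀ j (z : ℂ), 1 < z.re → qc j z = q j z) ∧
      IsClosed P ∧ (∀ z₀ : ℂ, ∀ᶠ s in 𝓝[≠] z₀, s ∉ P) ∧ (∀ z ∈ P, z.re ≤ 1) ∧
      (∀ g (z : ℂ), z ∉ P → AnalyticAt ℂ (fun z => Ec z g) z) ∧ (∀ j (z : ℂ), z ∉ P → AnalyticAt ℂ (qc j) z) ∧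
      (∀ g, DifferentiableOn ℂ (fun z => Ec z g) Pᶜ) ∧ (∀ j, DifferentiableOn ℂ (qc j) Pᶜ) ∧
      (∀ z : ℂ, z ∉ P → Continuous (Ec z)) ∧
      (∀ z₁ : ℂ, z₁ ∉ P → ∀ K : Set (quasiSplit (↥(maximalRealSubfield L)) L (IsCMField.complexConj L) 2).Adelic, IsCompact K → ∃ V ∈ 𝓝 z₁, ∃ M : ℝ, ∀ z ∈ V, ∀ g ∈ K, ‖Ec z g‖ ≤ M) := by
  classical
  -- the scattering coordinates (★ `exists_scatteringCoords_of_basis_cm_two`, general level)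
  obtain ⟨q, hq, hqφ⟩ := exists_scatteringCoords_of_basis_cm_two L ν h𝓕N h𝓕c hK' hφV hφc hφM bV
  have hli : LinearIndependent ℂ (fun j => ((bV j : ↥(chiSectionSpace (reflectChar (IsCMField.complexConj L) χ) K' ω)) : (quasiSplit (↥(maximalRealSubfield L)) L (IsCMField.complexConj L) 2).Adelic → ℂ)) :=
    bV.linearIndependent.map' (Submodule.subtype _) (Submodule.ker_subtype _)
  have hφ'χ : ∀ j, IsChiSection (reflectChar (IsCMField.complexConj L) χ) ((bV j : ↥(chiSectionSpace (reflectChar (IsCMField.complexConj L) χ) K' ω)) : (quasiSplit (↥(maximalRealSubfield L)) L (IsCMField.complexConj L) 2).Adelic → ℂ) := fun j => (bV j).2.1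
  -- ONE call of 📤 X2_χ (A)-eigen with the general-level (χ,τ) ball data (★ p860739) as `hCD`
  obtain ⟨Ec, qc, P, hE⟩ := chiEisenstein_meromorphic_exports_cm_two_of_letters_of_eigen_with_bound L μ νG ν h𝓕N h𝓕c h𝓕₀ hβ hμZ hφV hφc hφM hli hbc hφ'χ hbM q hq hqφ
    fun n => exists_chi_convData_level_cm_two L μ νG hβ hμZ μa μf hK' hKinf U₀ hU₀o hU₀c hU hVc n
  exact ⟨q, Ec, qc, P, hq, hqφ, hE⟩

end Level

end Summit.HodgeConjecture.HodgeConjecture.Cruxes.H413.K2E1ChiEisensteinMeromorphicExportsWithBoundCMTwo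

end
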